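import Literature.AlgebraicGeometry.AbelianSchemes.AbelianSchemeIsLambdaOfAtConjugate
import Literature.AlgebraicGeometry.AbelianSchemes.AbelianSchemeSymplecticLevel
import HarnessLib

/-!
# The conjugate transport of a symplectic lift along `conjFibreIso`: `x ↦ e((Λ_M x)^σ)` is a symplectic lift at the twisted point,
# with roots `σ(ζ_M)` ([Milne 2005] §14 «σ(A, λ, ηK) = (σA, σλ, σηK)»; [Shimura 1998] §18.6; [Lan 2013] Lemma 1.3.6.5)

Layer `Literature/AlgebraicGeometry/AbelianSchemes`; namespace `Literature.AlgebraicGeometry.AbelianSchemes.AbelianSchemeOver`.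
THEOREMS ONLY (no definition, no named fact, no instance, no `sorry`; the structure is built inside the proof of an `∃`).  Cell `hodgecm-mathlib`
(D-0151), FLOOR 0, P6 door (E) of `stub_RGD`, E6 step 8 — **E6-γ brick (CT)**: for ONE abelian scheme `A → S` with dual pair `D`, `λ : A → Â`, level-`N`
structure `φ`, a complex point `s`, a ring automorphism `σ` of `L`, witnesses `λ̄ = Λ(𝒪(Θ))` at `s` and `λ̄ = Λ(𝒪(Θ′))` at `Spec σ ≫ s`: a symplectic lift `Λ` of `φ`
at `s` for `Θ` is carried by `P ↦ e(P^σ)` (`e = conjFibreIso A σ s`, ★ `AbelianSchemeOverFibreConjugate`) to a symplectic lift of `φ` at `Spec σ ≫ s` for `Θ′`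
with roots `σ(ζ_M)` — bijective and tower-compatible because `(·)^σ` and `e` are group isomorphisms, equal to `φ(Spec σ ≫ s)` at level `N` by the section
junction ★ `map_conjFibreIso_conjPoints_restrictPt`, and a similitude by the `σ`-reading of the pairing ★ `IsLambdaOfAt.weilPairingLevel_specTwist_eq_conjugate`
(`ē^{Θ′}(e P^σ, e Q^σ) = σ ē^{Θ}(P, Q)`, witness-independent).  This is W3 H1's «Θσ ∕ hpair» at a point of ONE family, in ★ `SymplecticLift` currency; it feeds the
E6-γ rigidity step (two symplectic lifts at the twisted point: this one and the organ's).  `--supports stmt-HodgeConjecture-24832`, count-neutral; HC_CM is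
proved only modulo the printed citations until rung 0 closes.

## References
* [Milne2005ShimuraVarieties] J. S. Milne, *Introduction to Shimura varieties* (2005), §14 pp. 124–125, §6 Thm. 6.11 p. 75.
* [Shimura1998] G. Shimura, *Abelian Varieties with Complex Multiplication and Modular Functions* (1998), §18.6 (p. 130).
* [Lan2013PELCompactifications] K.-W. Lan, *Arithmetic compactifications of PEL-type Shimura varieties* (2013), §1.3.6 Lemma 1.3.6.5 (p. 81).
-/

set_option autoImplicit false

universe u

noncomputable section

open CategoryTheory CategoryTheory.Limits AlgebraicGeometry
open scoped MonObj

namespace Literature.AlgebraicGeometry.AbelianSchemes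

namespace AbelianSchemeOver

open Literature.AlgebraicGeometry.Motives

variable {S : Scheme.{u}} {A : AbelianSchemeOver S} {D : A.DualPair} {lam : A.X ⟶ D.hat.X} {g N : ℕ} {φ : A.LevelStructure g N}
  {L : Type u} [Field L] {s : Spec (.of L) ⟶ S} {δ : Fin g → ℕ}

/-- **(CT) CONJUGATE TRANSPORT OF A SYMPLECTIC LIFT.**  With `e := conjFibreIso A σ s : (A_s)^σ ≅ A_{Spec σ ≫ s}`: if `λ̄ = Λ(𝒪(Θ))` at `s` and
`λ̄ = Λ(𝒪(Θ′))` at `Spec σ ≫ s`, every symplectic lift `Λ` of `φ` at `s` for `Θ` yields a symplectic lift `Λ′` of `φ` at `Spec σ ≫ s` for `Θ′` with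
`ζ′_M = σ(ζ_M)` and `Λ′_M x = e((Λ_M x)^σ)` ON THE NOSE ([Milne2005ShimuraVarieties] §14 «`σ(A, λ, ηK) = (σA, σλ, σηK)`» on the torsion tower;
the similitude clause is [Shimura1998] §18.6 `e^{X^σ}(t^σ, s^σ) = e^X(t, s)^σ`, ★ `IsLambdaOfAt.weilPairingLevel_specTwist_eq_conjugate`).
[cite: Milne2005ShimuraVarieties, §14 pp. 124–125] [cite: Shimura1998, §18.6 proof (p. 130)] [cite: Lan2013PELCompactifications, §1.3.6 Lemma 1.3.6.5 (p. 81)] -/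
theorem LevelStructure.SymplecticLift.exists_conjTransport_lift_eq (σ : L ≃+* L)
    {Θ : CartierDivisor (A.fibre s).toAbelianVariety.X.left}
    {Θ' : CartierDivisor (A.fibre (specTwist σ ≫ s)).toAbelianVariety.X.left}
    (hΘ : A.IsLambdaOfAt s D lam Θ) (hΘ' : A.IsLambdaOfAt (specTwist σ ≫ s) D lam Θ') (Λ : φ.SymplecticLift s Θ δ) :
    ∃ Λ' : φ.SymplecticLift (specTwist σ ≫ s) Θ' δ,
      (∀ M, Λ'.ζ M = σ (Λ.ζ M)) ∧
      ∀ (M : ℕ) (x : Multiplicative (Fin g ⊕ Fin g → ZMod M)),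
        ((Λ'.lift M x : (A.fibre (specTwist σ ≫ s)).toAbelianVariety.torsionPoints L (M : ℤ)) :
            (A.fibre (specTwist σ ≫ s)).toAbelianVariety.Points L) =
          AlgPoints.map (A.conjFibreIso σ s).hom.hom.hom.hom
            ((A.fibre s).toAbelianVariety.conjPoints σ
              ((Λ.lift M x : (A.fibre s).toAbelianVariety.torsionPoints L (M : ℤ)) : (A.fibre s).toAbelianVariety.Points L)) := by
  -- adapted from ★ `LevelStructure.SymplecticLift.exists_transport_lift_eq` (SiegelAdmissibleOfIso §2), with `e⁻¹` replaced by `e ∘ (·)^σ`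
  -- the maps on `L`-points: `Φ = e ∘ (·)^σ` and its inverse `Ψ = ((·)^σ)⁻¹ ∘ e⁻¹`
  let cj : (A.fibre s).toAbelianVariety.Points L ≃* ((A.fibre s).toAbelianVariety.conjugate σ).Points L :=
    (A.fibre s).toAbelianVariety.conjPoints σ
  let eF : ((A.fibre s).toAbelianVariety.conjugate σ).Points L →* (A.fibre (specTwist σ ≫ s)).toAbelianVariety.Points L :=
    IsMonHom.monoidHom (A.conjFibreIso σ s).hom.hom.hom.hom (specOver L L)
  let eB : (A.fibre (specTwist σ ≫ s)).toAbelianVariety.Points L →* ((A.fibre s).toAbelianVariety.conjugate σ).Points L :=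
    IsMonHom.monoidHom (A.conjFibreIso σ s).inv.hom.hom.hom (specOver L L)
  let Φ : (A.fibre s).toAbelianVariety.Points L →* (A.fibre (specTwist σ ≫ s)).toAbelianVariety.Points L :=
    eF.comp cj.toMonoidHom
  let Ψ : (A.fibre (specTwist σ ≫ s)).toAbelianVariety.Points L →* (A.fibre s).toAbelianVariety.Points L :=
    cj.symm.toMonoidHom.comp eB
  have hΦ : ∀ P, Φ P = AlgPoints.map (A.conjFibreIso σ s).hom.hom.hom.hom ((A.fibre s).toAbelianVariety.conjPoints σ P) :=
    fun P => rfl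
  have heFB : ∀ Q, eF (eB Q) = Q := fun Q => by
    change AlgPoints.map (A.conjFibreIso σ s).hom.hom.hom.hom (AlgPoints.map (A.conjFibreIso σ s).inv.hom.hom.hom Q) = Q
    rw [← AlgPoints.map_comp_apply]
    change AlgPoints.map ((A.conjFibreIso σ s).inv ≫ (A.conjFibreIso σ s).hom).hom.hom.hom Q = Q
    rw [(A.conjFibreIso σ s).inv_hom_id]
    exact AlgPoints.map_id_apply Q
  have heBF : ∀ Q, eB (eF Q) = Q := fun Q => by
    change AlgPoints.map (A.conjFibreIso σ s).inv.hom.hom.hom (AlgPoints.map (A.conjFibreIso σ s).hom.hom.hom.hom Q) = Q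
    rw [← AlgPoints.map_comp_apply]
    change AlgPoints.map ((A.conjFibreIso σ s).hom ≫ (A.conjFibreIso σ s).inv).hom.hom.hom Q = Q
    rw [(A.conjFibreIso σ s).hom_inv_id]
    exact AlgPoints.map_id_apply Q
  have hΨΦ : ∀ P, Ψ (Φ P) = P := fun P => by
    change cj.symm (eB (eF (cj P))) = P
    rw [heBF, MulEquiv.symm_apply_apply]
  have hΦΨ : ∀ Q, Φ (Ψ Q) = Q := fun Q => by
    change eF (cj (cj.symm (eB Q))) = Q
    rw [MulEquiv.apply_symm_apply, heFB]
  -- `Φ` on the `M`-torsion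
  have hΦ_mem : ∀ (M : ℕ) (P : (A.fibre s).toAbelianVariety.torsionPoints L (M : ℤ)),
      Φ P ∈ (A.fibre (specTwist σ ≫ s)).toAbelianVariety.torsionPoints L (M : ℤ) := fun M P => by
    rw [AbelianVariety.mem_torsionPoints_iff, ← map_zpow, (AbelianVariety.mem_torsionPoints_iff _ _).1 P.2, map_one]
  let ΦT : ∀ M : ℕ, (A.fibre s).toAbelianVariety.torsionPoints L (M : ℤ) →*
      (A.fibre (specTwist σ ≫ s)).toAbelianVariety.torsionPoints L (M : ℤ) := fun M =>
    (Φ.comp ((A.fibre s).toAbelianVariety.torsionPoints L (M : ℤ)).subtype).codRestrict _ (hΦ_mem M)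
  have hΦT : ∀ (M : ℕ) (P : (A.fibre s).toAbelianVariety.torsionPoints L (M : ℤ)),
      ((ΦT M P : (A.fibre (specTwist σ ≫ s)).toAbelianVariety.torsionPoints L (M : ℤ)) :
        (A.fibre (specTwist σ ≫ s)).toAbelianVariety.Points L) = Φ P := fun M P => rfl
  refine ⟨{ ζ := fun M => σ (Λ.ζ M)
            isPrimitiveRoot_ζ := fun M hM hM₀ => (Λ.isPrimitiveRoot_ζ hM hM₀).map_of_injective σ.injective
            ζ_pow := fun M k hM hM₀ hk => by rw [← map_pow, Λ.ζ_pow k hM hM₀ hk]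
            lift := fun M => (ΦT M).comp (Λ.lift M)
            lift_bijective := ?_
            lift_compat := ?_
            lift_level := ?_
            pairing := ?_ }, fun M => rfl, fun M x => rfl⟩
  · -- bijectivity: `Φ` is a bijection on torsion points
    intro M hM hM₀
    have hinj : Function.Injective (ΦT M) := fun P Q hPQ => by
      have h := congrArg (fun R : (A.fibre (specTwist σ ≫ s)).toAbelianVariety.torsionPoints L (M : ℤ) =>
        Ψ (R : (A.fibre (specTwist σ ≫ s)).toAbelianVariety.Points L)) hPQ
      simp only [hΦT, hΨΦ] at h
      exact Subtype.ext h
    have hsurj : Function.Surjective (ΦT M) := fun Q => by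
      have hQ' : Ψ Q ∈ (A.fibre s).toAbelianVariety.torsionPoints L (M : ℤ) := by
        rw [AbelianVariety.mem_torsionPoints_iff, ← map_zpow, (AbelianVariety.mem_torsionPoints_iff _ _).1 Q.2, map_one]
      refine ⟨⟨Ψ Q, hQ'⟩, Subtype.ext ?_⟩
      rw [hΦT]
      exact hΦΨ Q
    rw [MonoidHom.coe_comp]
    exact (show Function.Bijective (ΦT M) from ⟨hinj, hsurj⟩).comp (Λ.lift_bijective hM hM₀)
  · -- tower compatibility
    intro M k x hM hM₀ hk
    change Φ _ = (Φ _ : (A.fibre (specTwist σ ≫ s)).toAbelianVariety.Points L) ^ k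
    rw [← map_pow]
    exact congrArg Φ (Λ.lift_compat k x hM hM₀ hk)
  · -- level `N`: `e((φᵢ(s))^σ) = φᵢ(Spec σ ≫ s)` (★ section junction)
    intro i
    change Φ ((Λ.lift N (Multiplicative.ofAdd (Pi.single i 1)) :
        (A.fibre s).toAbelianVariety.torsionPoints L (N : ℤ)) : (A.fibre s).toAbelianVariety.Points L) = _
    rw [Λ.lift_level i, hΦ]
    exact A.map_conjFibreIso_conjPoints_restrictPt σ s (φ.σ i)
  · -- the pairing clause: `ē^{Θ′}(e P^σ, e Q^σ) = σ (ē^{Θ}(P, Q)) = σ(ζ_M) ^ E_δ`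
    intro M hM hMΩ x y
    haveI := AbelianVariety.isDominant_toSchemeHom_zsmul_of_ne_zero (A.fibre (specTwist σ ≫ s)).toAbelianVariety hMΩ
    haveI := AbelianVariety.isDominant_toSchemeHom_zsmul_of_ne_zero (A.fibre s).toAbelianVariety hMΩ
    haveI := AbelianVariety.isDominant_toSchemeHom_zsmul_of_ne_zero ((A.fibre s).toAbelianVariety.conjugate σ) hMΩ
    haveI := A.isDominant_toSchemeHom_conjFibreIso_inv_comp_baseChangeHomFst σ s
    have key := hΘ.weilPairingLevel_specTwist_eq_conjugate A D lam σ s _ rfl hΘ'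
      (Λ.lift M (Multiplicative.ofAdd x)) (Λ.lift M (Multiplicative.ofAdd y))
      ((ΦT M).comp (Λ.lift M) (Multiplicative.ofAdd x)) ((ΦT M).comp (Λ.lift M) (Multiplicative.ofAdd y)) rfl rfl
    rw [key, Λ.weilPairingLevel_lift hM hMΩ x y, map_pow]

end AbelianSchemeOver

end Literature.AlgebraicGeometry.AbelianSchemes

end
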